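import Literature.Probability.LatticeModels.LoopErasedWalkIdentity
import HarnessLib

/-!
# Weighted sums over walks stopped at a set: hitting mass, Green's function, finiteness

Topic `Probability/LatticeModels`; namespace `Literature.Probability.LatticeModels.StoppedWalk`.
Foundations for the tree's proof of **Wilson's algorithm / Pemantle's theorem** (the branch of
the uniform spanning tree is a loop-erased random walk; `WilsonAlgorithm.lean`), following the
Green's-function ("Lawler") proof of Wilson's theorem: M. J. Kozdron, L. M. Richards,
D. W. Stroock, *Determinants, their applications to Markov processes, and a random walk proof of
Kirchhoff's matrix tree theorem*, arXiv:1306.2059 (2013), §3 and §5 ("Following a strategy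
developed by Greg Lawler"; G. F. Lawler, V. Limic, *Random Walk: A Modern Introduction* (2010),
Ch. 9); G. F. Lawler, Probab. Surveys 15 (2018), §2–§3.

Everything is phrased, as in `LoopErasedWalkIdentity.lean`, by `ℝ≥0∞`-valued sums over vertex
LISTS: a walk from `x` is `x :: t` and is summed over its tail `t`; the weight of a walk is the
product of a general one-step weight `q : V → V → ℝ≥0∞` along its steps (`pw q x t`; for the
simple random walk of a graph `q x y = 1/deg x` on edges). No Markov-chain measure theory is used:
"the probability that the walk from `x` stopped on hitting `S` does …" is the `q`-mass of the
corresponding set of stopped walks (Lawler 2018, §2: "`q(ω) = ∏ q(ωᵢ₋₁, ωᵢ)` … if `q` is the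
transition probability of a Markov chain, `q(ω)` is the probability of the path").

* `pw q x t` — the weight `q(x,t₀) q(t₀,t₁) ⋯` of the walk `x :: t`; `pw_append`.
* `wsum q x P = ∑_{t : P t} pw q x t` and its **first-step decomposition** `wsum_step`.
* `hit q S x` — the mass of the walks from `x` stopped on first hitting `S` (tails `t` with
  `IsStoppedAt S t`, `LoopErasure.lean`): the hitting probability `P_x[τ_S < ∞]` (`τ_S ≥ 1`).
* `loopAt q S x` — the Green's function `G_{Sᶜ}(x,x)`: closed walks at `x` with tail off `S`.
* `reach q S x y` — the walks from `x` to `y` with tail off `S` (`G_{Sᶜ}(x,y)`, `y ∉ S`).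
* `hit_le_one` — `P_x[τ_S < ∞] ≤ 1` for a substochastic weight (by the length filtration
  `hitLen`, `alive`: "stopped by time `n`" + "alive at time `n`" has mass `≤ 1`);
* `hit_eq_one` — `= 1` on a finite vertex set when `q` is stochastic off `S` and `S` can be
  reached from everywhere with positive weight (minimum principle for the `q`-harmonic function
  `x ↦ P_x[τ_S < ∞]`);
* `loopAt_ne_top`, `reach_ne_top` — finiteness of the Green's functions (a loop at `x` followed
  by a fixed positive-weight walk from `x` into `S` is a stopped walk, injectively).

## References

* M. J. Kozdron, L. M. Richards, D. W. Stroock, arXiv:1306.2059 (2013): §3 (accessibility,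
  Lemma 3.1: `max_x E_x[ξ^Δ] < ∞`; the Green's function `E_x[∑_{n ≤ ξ^Δ} 1_{y}(X_n)] =
  ∑_n (P^Δ)^n_{xy} < ∞`, eq. (3.3); `((I-P)^Δ)⁻¹_{xx} = 1/(1 - r_Δ(x))`), §5.
  [KozdronRichardsStroock2013]
* G. F. Lawler, *Topics in loop measures and the loop-erased walk*, Probab. Surveys 15 (2018),
  §2 (path weights `q(ω)`, Green's function `G_A(x,y) = ∑_{ω : x → y ⊆ A} q(ω)`). [Lawler2018]
* G. F. Lawler, V. Limic, *Random Walk: A Modern Introduction*, CUP (2010), Ch. 9 (the source of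
  the strategy, as cited by [KozdronRichardsStroock2013]). [LawlerLimic2010]
-/

noncomputable section

open scoped ENNReal Classical
open Literature.Probability.RandomPlanarGeometry
open Literature.Probability.LatticeModels.LoopErasedWalkIdentity

namespace Literature.Probability.LatticeModels

namespace StoppedWalk

variable {V : Type*}

/-! ### Path weights -/

section Weight

variable (q : V → V → ℝ≥0∞)

/-- The **weight of the walk `x :: t`**: the product of the one-step weights along its steps,
`q(x, t₀) q(t₀, t₁) ⋯ q(t_{n-2}, t_{n-1})` (Lawler 2018, §2: `q(ω) = ∏ᵢ q(ωᵢ₋₁, ωᵢ)`; the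
trivial walk has weight `1`). [cite: Lawler2018, §2] -/
def pw : V → List V → ℝ≥0∞
  | _, [] => 1
  | x, y :: t => q x y * pw y t

/-- The trivial walk has weight one. [folklore] -/
@[simp] theorem pw_nil (x : V) : pw q x [] = 1 := rfl

/-- The weight of a walk with a first step. [folklore] -/
@[simp] theorem pw_cons (x y : V) (t : List V) : pw q x (y :: t) = q x y * pw q y t := rfl

/-- The weight of a one-step walk. [folklore] -/
theorem pw_singleton (x y : V) : pw q x [y] = q x y := by simp

/-- **Weights multiply under concatenation**: the weight of `x :: (c ++ s)` is the weight of
`x :: c` times the weight of the walk `s` read from the last vertex of `x :: c`. [folklore] -/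
theorem pw_append (x : V) (c s : List V) :
    pw q x (c ++ s) = pw q x c * pw q ((x :: c).getLast (List.cons_ne_nil x c)) s := by
  induction c generalizing x with
  | nil => simp
  | cons y c ih =>
    rw [List.cons_append, pw_cons, ih, pw_cons, mul_assoc,
      List.getLast_cons (List.cons_ne_nil y c)]

/-- Concatenation at a return to the starting vertex: if `c` is empty or ends in `x`, the weight
of `x :: (c ++ s)` is the weight of the loop `x :: c` times that of `x :: s`. [folklore] -/
theorem pw_append_of_loop {x : V} {c : List V} (hc : c = [] ∨ c.getLast? = some x) (s : List V) :
    pw q x (c ++ s) = pw q x c * pw q x s := by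
  rw [pw_append, (getLast_cons_eq_iff x c).2 hc]

/-- Concatenation at a prescribed last vertex: if `c` ends in `z`, the weight of `x :: (c ++ s)`
is the weight of `x :: c` times that of `z :: s`. [folklore] -/
theorem pw_append_of_getLast? {x z : V} {c : List V} (hc : c.getLast? = some z) (s : List V) :
    pw q x (c ++ s) = pw q x c * pw q z s := by
  have hne : c ≠ [] := by rintro rfl; simp at hc
  rw [pw_append, List.getLast_cons hne]
  congr 2
  rw [List.getLast?_eq_some_getLast hne, Option.some_inj] at hc
  exact hc

/-- A walk of nonzero weight has nonzero weight on every initial piece and every final piece.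
[folklore] -/
theorem pw_cons_ne_zero_iff (x y : V) (t : List V) :
    pw q x (y :: t) ≠ 0 ↔ q x y ≠ 0 ∧ pw q y t ≠ 0 := by
  rw [pw_cons, mul_ne_zero_iff]

end Weight

/-! ### Sums over tails and the first-step decomposition -/

section Sums

variable (q : V → V → ℝ≥0∞)

/-- The `q`-mass `∑_{t : P t} pw q x t` of the walks `x :: t` whose tail satisfies `P`.
[folklore] -/
def wsum (x : V) (P : List V → Prop) : ℝ≥0∞ := ∑' t, if P t then pw q x t else 0

/-- A mass over an empty set of tails vanishes. [folklore] -/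
theorem wsum_eq_zero {x : V} {P : List V → Prop} (h : ∀ t, ¬ P t) : wsum q x P = 0 := by
  simp [wsum, h]

/-- The mass of the trivial walk alone is one. [folklore] -/
theorem wsum_eq_one_of_iff_nil {x : V} {P : List V → Prop} (h : ∀ t, P t ↔ t = []) :
    wsum q x P = 1 := by
  unfold wsum
  simp_rw [h]
  rw [tsum_ite_eq]
  rfl

/-- Monotonicity of the mass in the set of tails. [folklore] -/
theorem wsum_mono {x : V} {P P' : List V → Prop} (h : ∀ t, P t → P' t) :
    wsum q x P ≤ wsum q x P' := by
  unfold wsum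
  refine ENNReal.tsum_le_tsum fun t => ?_
  by_cases hP : P t
  · rw [if_pos hP, if_pos (h t hP)]
  · rw [if_neg hP]
    exact zero_le

/-- Masses of equivalent tail sets agree. [folklore] -/
theorem wsum_congr {x : V} {P P' : List V → Prop} (h : ∀ t, P t ↔ P' t) :
    wsum q x P = wsum q x P' := by
  unfold wsum
  exact tsum_congr fun t => ite_congr_prop _ _ (h t)

/-- **First-step decomposition**: a walk `x :: t` is trivial or makes a first step to some `y`
and continues as a walk from `y`; accordingly
`∑_{P t} pw q x t = [P []] + ∑_y q(x,y) ∑_{P (y :: t)} pw q y t`. [folklore] -/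
theorem wsum_step (x : V) (P : List V → Prop) :
    wsum q x P = (if P [] then 1 else 0) + ∑' y, q x y * wsum q y (fun t => P (y :: t)) := by
  unfold wsum
  rw [ENNReal.tsum_eq_add_tsum_ite []]
  refine congrArg₂ (· + ·) (by simp) ?_
  refine (tsum_eq_tsum_prod_cons _ (by simp)).trans ?_
  simp only [reduceCtorEq, if_false]
  rw [ENNReal.tsum_prod']
  refine tsum_congr fun y => ?_
  rw [← ENNReal.tsum_mul_left]
  refine tsum_congr fun t => ?_
  rw [pw_cons]
  split_ifs <;> simp

/-- The mass of a tail set splits according to the length of the tail. [folklore] -/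
theorem wsum_eq_tsum_length (x : V) (P : List V → Prop) :
    wsum q x P = ∑' n : ℕ, wsum q x (fun t => P t ∧ t.length = n) := by
  unfold wsum
  rw [tsum_eq_tsum_fiber (fun t => if P t then pw q x t else 0) List.length]
  refine tsum_congr fun n => tsum_congr fun t => ?_
  by_cases hP : P t <;> by_cases hn : t.length = n <;> simp [hP, hn]

end Sums

/-! ### Stopped walks, loops and transits -/

section Stopped

variable (q : V → V → ℝ≥0∞)

/-- **Hitting mass** `P_x[τ_S < ∞]` (`τ_S = min{n ≥ 1 : ωₙ ∈ S}`): the `q`-mass of the walks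
`x :: t` run until they FIRST hit `S` — tails `t` stopped at `S` (`IsStoppedAt S t`: nonempty,
last vertex in `S`, no earlier vertex in `S`). (Kozdron–Richards–Stroock (2013), §5:
"`P_x(ξ^Δ < ∞) = 1` for all `x ∈ V` and `Δ ⊊ V`".) [cite: KozdronRichardsStroock2013, §5] -/
def hit (S : Set V) (x : V) : ℝ≥0∞ := wsum q x (IsStoppedAt S)

/-- **The Green's function at the diagonal** `G_{Sᶜ}(x,x) = ∑_{ω : x → x, ω ⊆ Sᶜ} q(ω)`: the
`q`-mass of the closed walks `x :: t` at `x` (tails `t` empty or ending in `x`) whose tail stays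
off `S` (Lawler 2018, §2, "the Green's function"; Kozdron–Richards–Stroock (2013), §3, eq. (3.3)). The initial vertex is
not tested (in applications `x ∉ S`). [cite: Lawler2018, §2] -/
def loopAt (S : Set V) (x : V) : ℝ≥0∞ :=
  wsum q x (fun t => (t = [] ∨ t.getLast? = some x) ∧ Avoids S t)

/-- **The off-diagonal Green's function** `G_{Sᶜ}(x,y)`, `y ∉ S`: the `q`-mass of the walks
`x :: t` with nonempty tail ending in `y` and staying off `S`. [cite: Lawler2018, §2] -/
def reach (S : Set V) (x y : V) : ℝ≥0∞ :=
  wsum q x (fun t => t.getLast? = some y ∧ Avoids S t)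

/-- The hitting mass counted from time `0`: `1` if `x ∈ S`, else `P_x[τ_S < ∞]`. [folklore] -/
def hit' (S : Set V) (x : V) : ℝ≥0∞ := if x ∈ S then 1 else hit q S x

variable {q}

/-- When a walk `y :: t` is stopped at `S`: either `y ∈ S` and the walk stops at once, or
`y ∉ S` and the rest `t` is stopped at `S`. [folklore] -/
theorem isStoppedAt_cons_iff (S : Set V) (y : V) (t : List V) :
    IsStoppedAt S (y :: t) ↔ (y ∈ S ∧ t = []) ∨ (y ∉ S ∧ IsStoppedAt S t) := by
  constructor
  · intro h
    by_cases ht : t = []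
    · subst ht
      left
      exact ⟨by simpa using h.getLast_mem, rfl⟩
    · exact Or.inr ⟨h.head_not_mem ht, h.tail ht⟩
  · rintro (⟨hy, rfl⟩ | ⟨hy, h⟩)
    · exact isStoppedAt_singleton hy
    · exact h.cons hy

/-- The empty walk is not stopped anywhere. [folklore] -/
theorem not_isStoppedAt_nil (S : Set V) : ¬ IsStoppedAt S ([] : List V) := fun h => h.1 rfl

/-- Prefixing a stopped walk by vertices off `S` keeps it stopped at `S`. [folklore] -/
theorem isStoppedAt_append_left {S : Set V} {c t : List V} (hc : Avoids S c)
    (ht : IsStoppedAt S t) : IsStoppedAt S (c ++ t) := by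
  induction c with
  | nil => simpa using ht
  | cons a c ih =>
    rw [avoids_cons] at hc
    rw [List.cons_append]
    exact (ih hc.2).cons hc.1

/-- A stopped walk splits at any vertex off `S`: if `c ++ t` is stopped at `S` and `t ≠ []`,
then `c` avoids `S` and `t` is stopped at `S`. [folklore] -/
theorem isStoppedAt_of_append {S : Set V} {c t : List V} (h : IsStoppedAt S (c ++ t))
    (ht : t ≠ []) : Avoids S c ∧ IsStoppedAt S t := by
  induction c with
  | nil => exact ⟨avoids_nil S, by simpa using h⟩
  | cons a c ih =>
    rw [List.cons_append] at h
    have hne : c ++ t ≠ [] := by simp [ht]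
    obtain ⟨hc, ht'⟩ := ih (h.tail hne)
    exact ⟨avoids_cons.2 ⟨h.head_not_mem hne, hc⟩, ht'⟩

/-- The walks `y :: t` stopped at `S`, summed over `t`, have mass `hit' y`: one trivial walk if
`y ∈ S`, the hitting mass from `y` otherwise. [folklore] -/
theorem wsum_isStoppedAt_cons (S : Set V) (y : V) :
    wsum q y (fun t => IsStoppedAt S (y :: t)) = hit' q S y := by
  rw [hit']
  by_cases hy : y ∈ S
  · rw [if_pos hy]
    refine wsum_eq_one_of_iff_nil q fun t => ?_
    rw [isStoppedAt_cons_iff]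
    simp [hy]
  · rw [if_neg hy, hit]
    refine wsum_congr q fun t => ?_
    rw [isStoppedAt_cons_iff]
    simp [hy]

/-- **First-step decomposition of the hitting mass**: `P_x[τ_S < ∞] = ∑_y q(x,y) h'(y)` with
`h'(y) = 1` on `S` and `h'(y) = P_y[τ_S < ∞]` off `S` (the function `x ↦ P_x[τ_S < ∞]` is
`q`-harmonic off `S` with boundary value `1`; Kozdron–Richards–Stroock (2013), §3, (MP2)).
[cite: KozdronRichardsStroock2013, §3] -/
theorem hit_step (S : Set V) (x : V) : hit q S x = ∑' y, q x y * hit' q S y := by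
  rw [hit, wsum_step, if_neg (not_isStoppedAt_nil S), zero_add]
  exact tsum_congr fun y => by rw [wsum_isStoppedAt_cons]

/-! #### The length filtration: `P_x[τ_S ≤ n] + P_x[τ_S > n] ≤ 1` -/

/-- The mass of the walks from `x` stopped at `S` at time exactly `n`. [folklore] -/
def hitLen (q : V → V → ℝ≥0∞) (S : Set V) (x : V) (n : ℕ) : ℝ≥0∞ :=
  wsum q x (fun t => IsStoppedAt S t ∧ t.length = n)

/-- The mass of the walks from `x` of length `n` that have not hit `S` ("alive at time `n`").
[folklore] -/
def alive (q : V → V → ℝ≥0∞) (S : Set V) (x : V) (n : ℕ) : ℝ≥0∞ :=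
  wsum q x (fun t => Avoids S t ∧ t.length = n)

/-- No walk is stopped at time `0`. [folklore] -/
theorem hitLen_zero (S : Set V) (x : V) : hitLen q S x 0 = 0 :=
  wsum_eq_zero q fun _ h => h.1.1 (List.eq_nil_of_length_eq_zero h.2)

/-- At time `0` the walk is alive with mass one. [folklore] -/
theorem alive_zero (S : Set V) (x : V) : alive q S x 0 = 1 :=
  wsum_eq_one_of_iff_nil q fun t =>
    ⟨fun h => List.eq_nil_of_length_eq_zero h.2, fun h => by subst h; simp⟩

/-- First-step recursion for `hitLen`. [folklore] -/
theorem hitLen_succ (S : Set V) (x : V) (n : ℕ) :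
    hitLen q S x (n + 1) =
      ∑' y, q x y * (if y ∈ S then (if n = 0 then 1 else 0) else hitLen q S y n) := by
  rw [hitLen, wsum_step, if_neg (fun h => not_isStoppedAt_nil S h.1), zero_add]
  refine tsum_congr fun y => ?_
  congr 1
  by_cases hy : y ∈ S
  · rw [if_pos hy]
    by_cases hn : n = 0
    · rw [if_pos hn]
      refine wsum_eq_one_of_iff_nil q fun t => ?_
      rw [isStoppedAt_cons_iff]
      subst hn
      simp [hy]
    · rw [if_neg hn]
      refine wsum_eq_zero q fun t h => ?_
      obtain ⟨h, hl⟩ := h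
      rw [isStoppedAt_cons_iff] at h
      rcases h with ⟨-, rfl⟩ | ⟨hy', -⟩
      · exact hn (by simpa using hl.symm)
      · exact hy' hy
  · rw [if_neg hy, hitLen]
    refine wsum_congr q fun t => ?_
    rw [isStoppedAt_cons_iff]
    simp [hy]

/-- First-step recursion for `alive`. [folklore] -/
theorem alive_succ (S : Set V) (x : V) (n : ℕ) :
    alive q S x (n + 1) = ∑' y, q x y * (if y ∈ S then 0 else alive q S y n) := by
  rw [alive, wsum_step, if_neg (fun h => by simp at h), zero_add]
  refine tsum_congr fun y => ?_
  congr 1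
  by_cases hy : y ∈ S
  · rw [if_pos hy]
    exact wsum_eq_zero q fun t h => (avoids_cons.1 h.1).1 hy
  · rw [if_neg hy, alive]
    refine wsum_congr q fun t => ?_
    simp [hy]

/-- **Stopped by time `n` plus alive at time `n` has mass at most one** for a substochastic
weight (`∑_y q(z,y) ≤ 1` for all `z`). [folklore] -/
theorem sum_hitLen_add_alive_le_one (hsub : ∀ z, ∑' y, q z y ≤ 1) (S : Set V) :
    ∀ (n : ℕ) (x : V), (∑ k ∈ Finset.range (n + 1), hitLen q S x k) + alive q S x n ≤ 1 := by
  intro n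
  induction n with
  | zero => intro x; simp [hitLen_zero, alive_zero]
  | succ n ih =>
    intro x
    rw [Finset.sum_range_succ', hitLen_zero, add_zero]
    simp_rw [hitLen_succ, alive_succ]
    rw [← Summable.tsum_finsetSum (fun i _ => ENNReal.summable), ← ENNReal.tsum_add]
    calc ∑' y, ((∑ k ∈ Finset.range (n + 1),
            q x y * (if y ∈ S then (if k = 0 then 1 else 0) else hitLen q S y k)) +
            q x y * (if y ∈ S then 0 else alive q S y n))
        ≤ ∑' y, q x y * 1 := by
          refine ENNReal.tsum_le_tsum fun y => ?_
          rw [← Finset.mul_sum, ← mul_add]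
          refine mul_le_mul_right ?_ _
          by_cases hy : y ∈ S
          · simp only [if_pos hy, add_zero]
            simp
          · simp only [if_neg hy]
            exact ih y
      _ ≤ 1 := by simpa using hsub x

/-- The hitting mass is the total of the time-`n` hitting masses. [folklore] -/
theorem hit_eq_tsum_hitLen (S : Set V) (x : V) : hit q S x = ∑' n, hitLen q S x n :=
  wsum_eq_tsum_length q x _

/-- **The hitting mass is at most one** for a substochastic weight: `P_x[τ_S < ∞] ≤ 1`.
[cite: KozdronRichardsStroock2013, §5] -/
theorem hit_le_one (hsub : ∀ z, ∑' y, q z y ≤ 1) (S : Set V) (x : V) : hit q S x ≤ 1 := by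
  rw [hit_eq_tsum_hitLen, ENNReal.tsum_eq_iSup_nat]
  refine iSup_le fun n => ?_
  cases n with
  | zero => simp
  | succ n => exact le_trans (le_self_add) (sum_hitLen_add_alive_le_one hsub S n x)

/-- `hit' ≤ 1` for a substochastic weight. [folklore] -/
theorem hit'_le_one (hsub : ∀ z, ∑' y, q z y ≤ 1) (S : Set V) (x : V) : hit' q S x ≤ 1 := by
  rw [hit']
  split_ifs
  · exact le_rfl
  · exact hit_le_one hsub S x

/-! #### Finiteness of the Green's functions -/

/-- Appending a fixed walk: if every tail in `P`, followed by `t₀`, lies in `Q`, and the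
weights multiply, then `(∑_P pw) · pw(t₀) ≤ ∑_Q pw` (the map `c ↦ c ++ t₀` is injective).
[folklore] -/
theorem wsum_mul_pw_le_wsum {x z : V} {P Q : List V → Prop} (t₀ : List V)
    (hPQ : ∀ c, P c → Q (c ++ t₀)) (hpw : ∀ c, P c → pw q x (c ++ t₀) = pw q x c * pw q z t₀) :
    wsum q x P * pw q z t₀ ≤ wsum q x Q := by
  unfold wsum
  rw [← ENNReal.tsum_mul_right]
  refine le_trans ?_ (ENNReal.tsum_comp_le_tsum_of_injective (List.append_left_injective t₀)
    (fun t => if Q t then pw q x t else 0))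
  refine ENNReal.tsum_le_tsum fun c => ?_
  by_cases hP : P c
  · simp only [if_pos hP, if_pos (hPQ c hP), hpw c hP, le_refl]
  · simp only [if_neg hP, zero_mul, zero_le]

/-- A loop at `x` off `S` followed by a fixed walk from `x` stopped at `S` is a walk from `x`
stopped at `S`, injectively in the loop; hence `G_{Sᶜ}(x,x) · q(t₀) ≤ P_x[τ_S < ∞]`.
[cite: KozdronRichardsStroock2013, §3] -/
theorem loopAt_mul_pw_le_hit {S : Set V} {x : V} {t₀ : List V} (ht₀ : IsStoppedAt S t₀) :
    loopAt q S x * pw q x t₀ ≤ hit q S x :=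
  wsum_mul_pw_le_wsum t₀ (fun _ h => isStoppedAt_append_left h.2 ht₀) (fun _ h => pw_append_of_loop q h.1 t₀)

/-- A walk from `x` to `y` off `S` followed by a fixed walk from `y` stopped at `S` is a walk
from `x` stopped at `S`; hence `G_{Sᶜ}(x,y) · q(t₁) ≤ P_x[τ_S < ∞]`.
[cite: KozdronRichardsStroock2013, §3] -/
theorem reach_mul_pw_le_hit {S : Set V} {x y : V} {t₁ : List V} (ht₁ : IsStoppedAt S t₁) :
    reach q S x y * pw q y t₁ ≤ hit q S x :=
  wsum_mul_pw_le_wsum t₁ (fun _ h => isStoppedAt_append_left h.2 ht₁)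
    (fun _ h => pw_append_of_getLast? q h.1 t₁)

/-- **The Green's function `G_{Sᶜ}(x,x)` is finite** as soon as the weight is substochastic and
some walk of positive weight leads from `x` into `S` (Kozdron–Richards–Stroock (2013), §3:
under accessibility "the series on the right converges", eq. (3.3)).
[cite: KozdronRichardsStroock2013, §3 (Lemma 3.1, eq. (3.3))] -/
theorem loopAt_ne_top (hsub : ∀ z, ∑' y, q z y ≤ 1) {S : Set V} {x : V} {t₀ : List V}
    (ht₀ : IsStoppedAt S t₀) (hpos : pw q x t₀ ≠ 0) : loopAt q S x ≠ ⊤ := by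
  intro htop
  have h := (loopAt_mul_pw_le_hit (q := q) (x := x) ht₀).trans (hit_le_one hsub S x)
  rw [htop, ENNReal.top_mul hpos] at h
  exact ENNReal.one_lt_top.not_ge h

/-- **The Green's function `G_{Sᶜ}(x,y)` is finite** as soon as the weight is substochastic and
some walk of positive weight leads from `y` into `S`.
[cite: KozdronRichardsStroock2013, §3 (Lemma 3.1, eq. (3.3))] -/
theorem reach_ne_top (hsub : ∀ z, ∑' y, q z y ≤ 1) {S : Set V} {x y : V} {t₁ : List V}
    (ht₁ : IsStoppedAt S t₁) (hpos : pw q y t₁ ≠ 0) : reach q S x y ≠ ⊤ := by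
  intro htop
  have h := (reach_mul_pw_le_hit (q := q) (x := x) (y := y) ht₁).trans (hit_le_one hsub S x)
  rw [htop, ENNReal.top_mul hpos] at h
  exact ENNReal.one_lt_top.not_ge h

end Stopped

/-! ### The hitting mass is one on a finite state space (minimum principle) -/

section Finite

variable [Fintype V] {q : V → V → ℝ≥0∞}

/-- On a finite vertex set the first-step decomposition is a finite sum. [folklore] -/
theorem hit_step_sum (S : Set V) (x : V) : hit q S x = ∑ y, q x y * hit' q S y := by
  rw [hit_step, tsum_fintype]

/-- **`P_x[τ_S < ∞] = 1`** on a finite vertex set, for a weight that is substochastic, stochastic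
off `S`, and such that from every vertex off `S` some walk of positive weight leads into `S`
(minimum principle: at a vertex minimising `x ↦ P_x[τ_S < ∞]` every successor of positive
weight is again minimising, and following a positive walk into `S` the minimum is `1`).
(Kozdron–Richards–Stroock (2013), §5: "Since `P_x(ξ^Δ < ∞) = 1` for all `x ∈ V` and
`Δ ⊊ V` …".) [cite: KozdronRichardsStroock2013, §5] -/
theorem hit_eq_one (hsub : ∀ z, ∑' y, q z y ≤ 1) {S : Set V}
    (hstoch : ∀ z, z ∉ S → ∑ y, q z y = 1)
    (hreach : ∀ z, z ∉ S → ∃ t, IsStoppedAt S t ∧ pw q z t ≠ 0) {x : V} (hx : x ∉ S) :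
    hit q S x = 1 := by
  -- a vertex off `S` minimising the hitting mass
  obtain ⟨x₀, hx₀, hmin⟩ := Finset.exists_min_image (Finset.univ.filter fun z => z ∉ S)
    (hit q S) ⟨x, by simpa using hx⟩
  simp only [Finset.mem_filter, Finset.mem_univ, true_and] at hx₀ hmin
  set m := hit q S x₀ with hm
  have hm1 : m ≤ 1 := hit_le_one hsub S x₀
  have hge : ∀ y, m ≤ hit' q S y := fun y => by
    rw [hit']
    split_ifs with hy
    · exact hm1
    · exact hmin y hy
  -- at a minimising vertex every successor of positive weight is minimising
  have key : ∀ z, z ∉ S → hit q S z = m → ∀ y, q z y ≠ 0 → hit' q S y = m := by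
    intro z hz hzm y hq
    by_contra hne
    have hlt : m < hit' q S y := lt_of_le_of_ne (hge y) (Ne.symm hne)
    have hqtop : q z y ≠ ⊤ := by
      intro h
      have := hsub z
      rw [tsum_fintype] at this
      have h' : q z y ≤ 1 := (Finset.single_le_sum (fun _ _ => zero_le)
        (Finset.mem_univ y)).trans this
      rw [h] at h'
      exact ENNReal.one_lt_top.not_ge h'
    have hrest : ∑ w ∈ Finset.univ.erase y, q z w * m ≠ ⊤ := by
      refine ne_top_of_le_ne_top ENNReal.one_ne_top ?_
      calc ∑ w ∈ Finset.univ.erase y, q z w * m ≤ ∑ w, q z w * m :=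
            Finset.sum_le_sum_of_subset (Finset.erase_subset _ _)
        _ ≤ ∑ w, q z w * 1 := Finset.sum_le_sum fun w _ => mul_le_mul_right hm1 _
        _ = 1 := by simpa using hstoch z hz
    have h1 : ∑ w, q z w * m < ∑ w, q z w * hit' q S w := by
      rw [← Finset.add_sum_erase _ _ (Finset.mem_univ y),
        ← Finset.add_sum_erase _ _ (Finset.mem_univ y)]
      exact ENNReal.add_lt_add_of_lt_of_le hrest
        (ENNReal.mul_lt_mul_right hq hqtop hlt)
        (Finset.sum_le_sum fun w _ => mul_le_mul_right (hge w) _)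
    rw [← hit_step_sum, hzm, ← Finset.sum_mul, hstoch z hz, one_mul] at h1
    exact lt_irrefl _ h1
  -- follow a positive-weight walk from a minimising vertex into `S`
  have walk : ∀ (t : List V) (z : V), z ∉ S → hit q S z = m → IsStoppedAt S t →
      pw q z t ≠ 0 → m = 1 := by
    intro t
    induction t with
    | nil => exact fun z _ _ h _ => absurd h (not_isStoppedAt_nil S)
    | cons y t ih =>
      intro z hz hzm hst hpw
      rw [pw_cons_ne_zero_iff] at hpw
      have hy := key z hz hzm y hpw.1
      rw [hit'] at hy
      rw [isStoppedAt_cons_iff] at hst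
      rcases hst with ⟨hyS, -⟩ | ⟨hyS, hst⟩
      · rw [if_pos hyS] at hy
        exact hy.symm
      · rw [if_neg hyS] at hy
        exact ih y hyS hy hst hpw.2
  obtain ⟨t₀, ht₀, hpos⟩ := hreach x₀ hx₀
  have hm_one : m = 1 := walk t₀ x₀ hx₀ rfl ht₀ hpos
  exact le_antisymm (hit_le_one hsub S x) (hm_one ▸ hmin x hx)

/-- `hit' = 1` under the hypotheses of `hit_eq_one`. [folklore] -/
theorem hit'_eq_one (hsub : ∀ z, ∑' y, q z y ≤ 1) {S : Set V}
    (hstoch : ∀ z, z ∉ S → ∑ y, q z y = 1)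
    (hreach : ∀ z, z ∉ S → ∃ t, IsStoppedAt S t ∧ pw q z t ≠ 0) (x : V) :
    hit' q S x = 1 := by
  rw [hit']
  split_ifs with hx
  · rfl
  · exact hit_eq_one hsub hstoch hreach hx

end Finite

end StoppedWalk

end Literature.Probability.LatticeModels
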